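import Summits.Ventures.LatticeQCDFlow.Scoring.ParityLegBernsteinConfidence
import Summits.Ventures.LatticeQCDFlow.Scoring.ParityLegConfidenceColumns
import HarnessLib

/-!
# The parity leg from finitely many draws, IV: the three columns of an A-vs-B table with
# variance-adaptive (self-bounding) radii

HONEST FRAMING: exact (Metropolis-corrected) sampling algorithms for lattice gauge theory;
figures of merit are autocorrelation/cost numbers at stated couplings and volumes; no
continuum-physics claim.

Venture `LatticeQCDFlow` (cell pub-lqcd), topic `Scoring`; FANOUT row 4 (`s0-u1-b`, rung S0-B:
two independent codes A, B for the 2D U(1) flow sampler, compared column by column).  Parts I–II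
(`Scoring/ParityLegConfidence.lean`, `ParityLegConfidenceColumns.lean`) composed the deterministic
parity laws of the three leaderboard columns with HOEFFDING certificates for the masses of the
parity-failure set `E`; part III (`Scoring/ParityLegBernsteinConfidence.lean`) replaced the Hoeffding
radius `M√(a/2)` of a score `F ∈ [0, M]` by the EMPIRICAL self-bounded radius `√(2MaF̄) + 2Ma`
(confidence `1 − e^{−na}` in both cases; `a = log(1/η)/n` at level `η`).  This file re-composes the
three columns with the new radii — same laws, same legs, same union bounds; only the thresholds
change:

* ACCEPTANCE (`Exactness.MeanAcceptLipschitz.abs_meanAccept_sub_le_of_logParityOff`: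
  `|acc − acc'| ≤ (e^{δ} − 1)∫_{Eᶜ}q + q(E) + q'(E)`), failure COUNTS, `M = 1`:
  threshold `(e^{δ} − 1) + (p̂ + √(2ap̂) + 2a) + (p̂' + √(2a'p̂') + 2a')`;
* `τ_int` (the symmetric law `Exactness.abs_tauInt_sub_le_of_logParityOff_of_weightBounds`:
  `|τ − τ'| ≤ (e^{δ} − 1)(min(τ,τ') + ½) + e^{−δ}·4(B·max(C,C')/Z)²·(∫_E w)/∫g²w`),
  importance-WEIGHTED failures, `M = C/Z`: the target-mass slot `∫_E w` becomes
  `Z·(Π̂/n + √(2(C/Z)a·Π̂/n) + 2(C/Z)a)`;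
* ESS (`Exactness.TargetSideParityESS.abs_inv_integral_sq_div_sub_le_of_logParityOff`:
  `|ESS − ESS'| ≤ (e^{δ} − 1)ESS' + ∫_E p²/q + ∫_E p²/q'`), SQUARED-weight failures, `M = W²`,
  `W'²`: thresholds `Σ̂/n + √(2W²a·Σ̂/n) + 2W²a` and primed.

NEW WORK of the cell (elementary compositions); the one cited fact behind it is
Boucheron–Lugosi–Massart 2013 Exercise 2.9 (= Maurer 2003), proved in the tree
(`Literature.Probability.Moments.NonnegativeLowerTail`); no definition is introduced.

## What is proved

* **`acceptance_parityLeg_selfRadius_confidence`** (+ `_level`) — `P(threshold < |acc(p,q) −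
  acc(p,q')|) ≤ e^{−na} + e^{−n'a'}` (`≤ η + η'`).
* **`tauInt_parityLeg_selfRadius_confidence`** — one leg of `n ≥ 1` independent draws from `q`:
  `P( (e^{δ} − 1)(min(τ,τ') + ½) + e^{−δ}·4(B·max(C,C')/Z)²·Z·R̂/∫g²w < |τ − τ'| ) ≤ e^{−na}`,
  `R̂ = Π̂/n + √(2(C/Z)a·Π̂/n) + 2(C/Z)a`.
* `weightLevel_pos` — a ceiling `p ≤ Wq` over a normalised `p` forces `W > 0`.
* **`ess_parityLeg_selfRadius_confidence`** — two legs: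
  `P( (e^{δ} − 1) + R̂ + R̂' < |ESS − ESS'| ) ≤ e^{−na} + e^{−n'a'}`.

Reading for row 4 (value-free; no number of ours, no sealed value): per column the certified
discrepancy threshold is the deterministic parity term plus, per leg, `mass estimate +
√(2·level·a·estimate) + 2·level·a` with `level ∈ {1, C/Z, W²}` — where parts I–II had
`estimate + level·√(a/2)`.  For rare failures the statistical part of the threshold is now of the
order of the estimate itself plus `2·level·log(1/η)/n`, instead of `level·√(log(1/η)/(2n))`.
NOT CLAIMED: as in parts I–III (no chain frame, `δ`, `C`, `W`, `∫ g² w` are inputs, constants not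
optimised, the ESS threshold keeps `e^{δ} − 1` in place of `(e^{δ} − 1)·ESS'`, no number re-scored).
-/

noncomputable section

namespace Summit.Ventures.LatticeQCDFlow.Scoring.ParityLeg

open MeasureTheory ProbabilityTheory Finset Real Set
open Summit.Ventures.LatticeQCDFlow.Exactness

variable {Ω : Type*} [MeasurableSpace Ω] {P : Measure Ω} [IsProbabilityMeasure P] {ι : Type*}
variable {X : Type*} [MeasurableSpace X] {μ : Measure X}

/-! ## §1 The acceptance column -/

/-- **THE ACCEPTANCE COLUMN OF AN A-vs-B TABLE WITH EMPIRICAL (SELF-BOUNDED) RADII.**  `(X, μ)`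
s-finite; `p ≥ 0` a normalised target density; `q, q' > 0` two normalised model densities (the two
codes); parity `|log q − log q'| ≤ δ` off a measurable `E`, `δ ≥ 0`;
`acc(p, q) = ∫∫ min(p(x)q(y), p(y)q(x))` the equilibrium acceptance of the flow sampler with model
`q`.  LEGS: independent draws `xᵢ` (`i ∈ s`, `n = #s ≥ 1`) from `q` with failure frequency
`p̂ = (Σ 1_E(xᵢ))/n`, independent draws `x'ⱼ` (`j ∈ s'`, `n' ≥ 1`) from `q'` with `p̂'` likewise —
nothing assumed between the legs; `a, a' ≥ 0`.  Then
`P( (e^{δ} − 1) + (p̂ + √(2ap̂) + 2a) + (p̂' + √(2a'p̂') + 2a') < |acc(p,q) − acc(p,q')| )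
≤ e^{−na} + e^{−n'a'}`. [ours] -/
theorem acceptance_parityLeg_selfRadius_confidence [SFinite μ] {p q q' : X → ℝ}
    (hp0 : ∀ y, 0 ≤ p y) (hpm : Measurable p) (hpi : Integrable p μ) (hp1 : ∫ y, p y ∂μ = 1)
    (hq0 : ∀ y, 0 < q y) (hqm : Measurable q) (hqi : Integrable q μ) (hq1 : ∫ y, q y ∂μ = 1)
    (hq0' : ∀ y, 0 < q' y) (hqm' : Measurable q') (hqi' : Integrable q' μ)
    (hq1' : ∫ y, q' y ∂μ = 1) {E : Set X} (hE : MeasurableSet E) {δ : ℝ} (hδ : 0 ≤ δ)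
    (hlog : ∀ y, y ∉ E → |Real.log (q y) - Real.log (q' y)| ≤ δ)
    {x : ι → Ω → X} (hind : iIndepFun x P) (hxm : ∀ i, Measurable (x i))
    (hlaw : ∀ i, Measure.map (x i) P = μ.withDensity fun y => ENNReal.ofReal (q y))
    {ι' : Type*} {x' : ι' → Ω → X} (hind' : iIndepFun x' P) (hxm' : ∀ j, Measurable (x' j))
    (hlaw' : ∀ j, Measure.map (x' j) P = μ.withDensity fun y => ENNReal.ofReal (q' y))
    (s : Finset ι) (s' : Finset ι') (hs : 0 < s.card) (hs' : 0 < s'.card) {a a' : ℝ}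
    (ha : 0 ≤ a) (ha' : 0 ≤ a') :
    P.real {ω | (Real.exp δ - 1)
          + ((∑ i ∈ s, E.indicator (fun _ => (1 : ℝ)) (x i ω)) / s.card
              + Real.sqrt (2 * a * ((∑ i ∈ s, E.indicator (fun _ => (1 : ℝ)) (x i ω)) / s.card))
              + 2 * a)
          + ((∑ j ∈ s', E.indicator (fun _ => (1 : ℝ)) (x' j ω)) / s'.card
              + Real.sqrt (2 * a'
                  * ((∑ j ∈ s', E.indicator (fun _ => (1 : ℝ)) (x' j ω)) / s'.card))
              + 2 * a')
        < |(∫ b, ∫ c, min (p b * q c) (p c * q b) ∂μ ∂μ)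
            - ∫ b, ∫ c, min (p b * q' c) (p c * q' b) ∂μ ∂μ|}
      ≤ Real.exp (-(s.card * a)) + Real.exp (-(s'.card * a')) := by
  have hlaw_acc := Exactness.MeanAcceptLipschitz.abs_meanAccept_sub_le_of_logParityOff hp0 hpm hpi
    hp1 hq0 hqm hqi hq1 hq0' hqm' hqi' hq1' hE hlog
  have hA := modelMass_le_freq_selfRadius_confidence hind hxm (fun y => (hq0 y).le) hqm hlaw hE ha
    s hs
  have hA' := modelMass_le_freq_selfRadius_confidence hind' hxm' (fun y => (hq0' y).le) hqm' hlaw'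
    hE ha' s' hs'
  -- `∫_{Eᶜ} q ≤ 1`, so the parity term is at most `e^δ − 1`
  have hEc : ∫ y in Eᶜ, q y ∂μ ≤ 1 := by
    rw [← hq1]
    exact setIntegral_le_integral hqi (Filter.Eventually.of_forall fun y => (hq0 y).le)
  have hexp : 0 ≤ Real.exp δ - 1 := by linarith [Real.add_one_le_exp δ]
  set R : Ω → ℝ := fun ω => (∑ i ∈ s, E.indicator (fun _ => (1 : ℝ)) (x i ω)) / s.card
      + Real.sqrt (2 * a * ((∑ i ∈ s, E.indicator (fun _ => (1 : ℝ)) (x i ω)) / s.card))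
      + 2 * a with hR
  set R' : Ω → ℝ := fun ω => (∑ j ∈ s', E.indicator (fun _ => (1 : ℝ)) (x' j ω)) / s'.card
      + Real.sqrt (2 * a' * ((∑ j ∈ s', E.indicator (fun _ => (1 : ℝ)) (x' j ω)) / s'.card))
      + 2 * a' with hR'
  -- the bad event forces one of the two legs to under-cover its model mass
  have hsub : {ω | (Real.exp δ - 1) + R ω + R' ω
        < |(∫ b, ∫ c, min (p b * q c) (p c * q b) ∂μ ∂μ)
            - ∫ b, ∫ c, min (p b * q' c) (p c * q' b) ∂μ ∂μ|}
      ⊆ {ω | R ω ≤ ∫ y in E, q y ∂μ} ∪ {ω | R' ω ≤ ∫ y in E, q' y ∂μ} := by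
    intro ω hω
    simp only [mem_setOf_eq, mem_union] at hω ⊢
    by_contra hcon
    obtain ⟨h1, h2⟩ := not_or.mp hcon
    have h1 := not_le.mp h1
    have h2 := not_le.mp h2
    have h3 : (Real.exp δ - 1) * ∫ y in Eᶜ, q y ∂μ ≤ Real.exp δ - 1 := by
      have := mul_le_mul_of_nonneg_left hEc hexp
      linarith
    linarith
  calc P.real {ω | (Real.exp δ - 1) + R ω + R' ω
          < |(∫ b, ∫ c, min (p b * q c) (p c * q b) ∂μ ∂μ)
              - ∫ b, ∫ c, min (p b * q' c) (p c * q' b) ∂μ ∂μ|}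
      ≤ P.real ({ω | R ω ≤ ∫ y in E, q y ∂μ} ∪ {ω | R' ω ≤ ∫ y in E, q' y ∂μ}) :=
        measureReal_mono hsub
    _ ≤ P.real {ω | R ω ≤ ∫ y in E, q y ∂μ} + P.real {ω | R' ω ≤ ∫ y in E, q' y ∂μ} :=
        measureReal_union_le _ _
    _ ≤ Real.exp (-(s.card * a)) + Real.exp (-(s'.card * a')) := add_le_add hA hA'

/-- **The same at prescribed confidence levels.**  With `a = log(1/η)/n`, `a' = log(1/η')/n'`
(`0 < η, η' ≤ 1`) the empirical radii are `√(2 p̂ log(1/η)/n) + 2 log(1/η)/n` and likewise primed,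
and `P( (e^{δ} − 1) + (p̂ + …) + (p̂' + …) < |acc(p,q) − acc(p,q')| ) ≤ η + η'`. [ours] -/
theorem acceptance_parityLeg_selfRadius_confidence_level [SFinite μ] {p q q' : X → ℝ}
    (hp0 : ∀ y, 0 ≤ p y) (hpm : Measurable p) (hpi : Integrable p μ) (hp1 : ∫ y, p y ∂μ = 1)
    (hq0 : ∀ y, 0 < q y) (hqm : Measurable q) (hqi : Integrable q μ) (hq1 : ∫ y, q y ∂μ = 1)
    (hq0' : ∀ y, 0 < q' y) (hqm' : Measurable q') (hqi' : Integrable q' μ)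
    (hq1' : ∫ y, q' y ∂μ = 1) {E : Set X} (hE : MeasurableSet E) {δ : ℝ} (hδ : 0 ≤ δ)
    (hlog : ∀ y, y ∉ E → |Real.log (q y) - Real.log (q' y)| ≤ δ)
    {x : ι → Ω → X} (hind : iIndepFun x P) (hxm : ∀ i, Measurable (x i))
    (hlaw : ∀ i, Measure.map (x i) P = μ.withDensity fun y => ENNReal.ofReal (q y))
    {ι' : Type*} {x' : ι' → Ω → X} (hind' : iIndepFun x' P) (hxm' : ∀ j, Measurable (x' j))
    (hlaw' : ∀ j, Measure.map (x' j) P = μ.withDensity fun y => ENNReal.ofReal (q' y))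
    (s : Finset ι) (s' : Finset ι') (hs : 0 < s.card) (hs' : 0 < s'.card) {η η' : ℝ}
    (hη : 0 < η) (hη1 : η ≤ 1) (hη' : 0 < η') (hη1' : η' ≤ 1) :
    P.real {ω | (Real.exp δ - 1)
          + ((∑ i ∈ s, E.indicator (fun _ => (1 : ℝ)) (x i ω)) / s.card
              + Real.sqrt (2 * (Real.log (1 / η) / s.card)
                  * ((∑ i ∈ s, E.indicator (fun _ => (1 : ℝ)) (x i ω)) / s.card))
              + 2 * (Real.log (1 / η) / s.card))
          + ((∑ j ∈ s', E.indicator (fun _ => (1 : ℝ)) (x' j ω)) / s'.card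
              + Real.sqrt (2 * (Real.log (1 / η') / s'.card)
                  * ((∑ j ∈ s', E.indicator (fun _ => (1 : ℝ)) (x' j ω)) / s'.card))
              + 2 * (Real.log (1 / η') / s'.card))
        < |(∫ b, ∫ c, min (p b * q c) (p c * q b) ∂μ ∂μ)
            - ∫ b, ∫ c, min (p b * q' c) (p c * q' b) ∂μ ∂μ|}
      ≤ η + η' := by
  have hn : (0 : ℝ) < s.card := by exact_mod_cast hs
  have hn' : (0 : ℝ) < s'.card := by exact_mod_cast hs'
  have hL : ∀ {θ : ℝ}, 0 < θ → θ ≤ 1 → 0 ≤ Real.log (1 / θ) := fun hθ hθ1 =>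
    Real.log_nonneg (by rw [le_div_iff₀ hθ, one_mul]; exact hθ1)
  -- `exp(−n·(log(1/η)/n)) = η`
  have hrad : ∀ {n θ : ℝ}, 0 < n → 0 < θ → Real.exp (-(n * (Real.log (1 / θ) / n))) = θ := by
    intro n θ hn hθ
    rw [mul_div_cancel₀ _ hn.ne', Real.exp_neg, Real.exp_log (by positivity), one_div, inv_inv]
  have h := acceptance_parityLeg_selfRadius_confidence hp0 hpm hpi hp1 hq0 hqm hqi hq1 hq0' hqm'
    hqi' hq1' hE hδ hlog hind hxm hlaw hind' hxm' hlaw' s s' hs hs'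
    (div_nonneg (hL hη hη1) hn.le) (div_nonneg (hL hη' hη1') hn'.le)
    (a := Real.log (1 / η) / s.card) (a' := Real.log (1 / η') / s'.card)
  rw [hrad hn hη, hrad hn' hη'] at h
  exact h

/-! ## §2 The `τ_int` column -/

/-- **THE `τ_int` COLUMN OF AN A-vs-B TABLE WITH THE EMPIRICAL RADIUS.**  In the setting of
`Exactness.abs_tauInt_sub_le_of_logParityOff_of_weightBounds` (`(X, μ)` s-finite; two weight-bounded
flow samplers `imhOp μ w q`, `imhOp μ w q'` at the common target weight `w > 0`, `Z = ∫ w`; ceilings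
`w ≤ Cq`, `w ≤ C'q'`; parity `δ` off a measurable `E`; a centred bounded observable `g`, `|g| ≤ B`,
`A = ∫ g² w > 0`), let `xᵢ`, `i ∈ s` (`n = #s ≥ 1`), be independent draws from the model `q`,
`Π̂ = Σ_{i∈s} 1_E(xᵢ)·w(xᵢ)/(Z q(xᵢ))` their importance-weighted failure sum and, for `a ≥ 0`,
`R̂ = Π̂/n + √(2(C/Z)a·Π̂/n) + 2(C/Z)a`.  Then
`P( (e^{δ} − 1)(min(τ,τ') + ½) + e^{−δ}·4(B·max(C,C')/Z)²·(Z·R̂)/A < |τ − τ'| ) ≤ e^{−na}`.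
[ours] -/
theorem tauInt_parityLeg_selfRadius_confidence [SFinite μ] {w q q' : X → ℝ} (hw0 : ∀ y, 0 < w y)
    (hwm : Measurable w) (hwi : Integrable w μ) (hq0 : ∀ y, 0 < q y) (hqm : Measurable q)
    (hqi : Integrable q μ) (hq1 : ∫ z, q z ∂μ = 1) (hq0' : ∀ y, 0 < q' y) (hqm' : Measurable q')
    (hqi' : Integrable q' μ) (hq1' : ∫ z, q' z ∂μ = 1) {C C' : ℝ} (hC : ∀ y, w y ≤ C * q y)
    (hC' : ∀ y, w y ≤ C' * q' y) {E : Set X} (hE : MeasurableSet E) {δ : ℝ}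
    (hlog : ∀ y, y ∉ E → |Real.log (q y) - Real.log (q' y)| ≤ δ) {g : X → ℝ} (hgm : Measurable g)
    {B : ℝ} (hgb : ∀ y, |g y| ≤ B) (hg0 : ∫ y, g y * w y ∂μ = 0) (hA : 0 < ∫ y, g y ^ 2 * w y ∂μ)
    {x : ι → Ω → X} (hind : iIndepFun x P) (hxm : ∀ i, Measurable (x i))
    (hlaw : ∀ i, Measure.map (x i) P = μ.withDensity fun y => ENNReal.ofReal (q y))
    (s : Finset ι) (hs : 0 < s.card) {a : ℝ} (ha : 0 ≤ a) :
    P.real {ω | (Real.exp δ - 1)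
          * (min (tauInt (fun k => (∫ y, g y * ((imhOp μ w q)^[k] g) y * w y ∂μ)
                / ∫ y, g y ^ 2 * w y ∂μ))
              (tauInt (fun k => (∫ y, g y * ((imhOp μ w q')^[k] g) y * w y ∂μ)
                / ∫ y, g y ^ 2 * w y ∂μ)) + 1 / 2)
          + Real.exp (-δ) * (4 * (B * (max C C' / ∫ z, w z ∂μ)) ^ 2
              * ((∫ z, w z ∂μ)
                * (((∑ i ∈ s, E.indicator (fun y => w y / ((∫ z, w z ∂μ) * q y)) (x i ω)) / s.card
                  + Real.sqrt (2 * (C / (∫ z, w z ∂μ) * a)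
                      * ((∑ i ∈ s, E.indicator (fun y => w y / ((∫ z, w z ∂μ) * q y)) (x i ω))
                        / s.card))
                  + 2 * (C / (∫ z, w z ∂μ) * a))))) / ∫ y, g y ^ 2 * w y ∂μ
        < |tauInt (fun k => (∫ y, g y * ((imhOp μ w q)^[k] g) y * w y ∂μ) / ∫ y, g y ^ 2 * w y ∂μ)
            - tauInt (fun k => (∫ y, g y * ((imhOp μ w q')^[k] g) y * w y ∂μ)
                / ∫ y, g y ^ 2 * w y ∂μ)|}
      ≤ Real.exp (-(s.card * a)) := by
  obtain ⟨hZ, hCpos, -, -⟩ := rate_bounds hw0 hwi hq0 hqi hq1 hC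
  have hlawτ := abs_tauInt_sub_le_of_logParityOff_of_weightBounds hw0 hwm hwi hq0 hqm hqi hq1 hq0'
    hqm' hqi' hq1' hC hC' hE hlog hgm hgb hg0 hA
  have hleg := targetMass_le_weightedFreq_selfRadius_confidence hind hxm hq0 hqm hlaw
    (fun y => (hw0 y).le) hwm hZ hCpos hC hE ha s hs
  set Z : ℝ := ∫ z, w z ∂μ with hZdef
  set A : ℝ := ∫ y, g y ^ 2 * w y ∂μ with hAdef
  set τ : ℝ := tauInt (fun k => (∫ y, g y * ((imhOp μ w q)^[k] g) y * w y ∂μ) / A)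
  set τ' : ℝ := tauInt (fun k => (∫ y, g y * ((imhOp μ w q')^[k] g) y * w y ∂μ) / A)
  set Rw : Ω → ℝ := fun ω =>
      (∑ i ∈ s, E.indicator (fun y => w y / (Z * q y)) (x i ω)) / s.card
      + Real.sqrt (2 * (C / Z * a)
          * ((∑ i ∈ s, E.indicator (fun y => w y / (Z * q y)) (x i ω)) / s.card))
      + 2 * (C / Z * a) with hRw
  have hsub : {ω | (Real.exp δ - 1) * (min τ τ' + 1 / 2)
          + Real.exp (-δ) * (4 * (B * (max C C' / Z)) ^ 2 * (Z * Rw ω)) / A < |τ - τ'|}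
      ⊆ {ω | Rw ω ≤ (∫ y in E, w y ∂μ) / Z} := by
    intro ω hω
    simp only [mem_setOf_eq] at hω ⊢
    by_contra hcon
    have hmass : ∫ y in E, w y ∂μ < Z * Rw ω := by
      have := not_le.mp hcon
      rwa [div_lt_iff₀ hZ, mul_comm] at this
    -- the coefficient of the target mass in the deterministic law is nonnegative
    have hmono : Real.exp (-δ) * (4 * (B * (max C C' / Z)) ^ 2 * ∫ y in E, w y ∂μ) / A
        ≤ Real.exp (-δ) * (4 * (B * (max C C' / Z)) ^ 2 * (Z * Rw ω)) / A :=
      div_le_div_of_nonneg_right (mul_le_mul_of_nonneg_left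
        (mul_le_mul_of_nonneg_left hmass.le (by positivity)) (Real.exp_pos _).le) hA.le
    linarith
  exact (measureReal_mono hsub).trans hleg

/-! ## §3 The ESS column -/

/-- A weight ceiling `p ≤ W q` over a NORMALISED `p ≥ 0` (with `q > 0`) forces `W > 0`: otherwise
`p ≤ 0`, `p = 0`, `∫ p = 0 ≠ 1`. [folklore] -/
theorem weightLevel_pos {p q : X → ℝ} (hp0 : ∀ y, 0 ≤ p y) (hp1 : ∫ y, p y ∂μ = 1)
    (hq0 : ∀ y, 0 < q y) {W : ℝ} (hW : ∀ y, p y ≤ W * q y) : 0 < W := by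
  by_contra hW0
  have hW0 := not_lt.mp hW0
  have hp : ∀ y, p y = 0 := fun y =>
    le_antisymm ((hW y).trans (mul_nonpos_of_nonpos_of_nonneg hW0 (hq0 y).le)) (hp0 y)
  have : ∫ y, p y ∂μ = 0 := by simp [hp]
  rw [this] at hp1
  exact zero_ne_one hp1

/-- **THE ESS COLUMN OF AN A-vs-B TABLE WITH EMPIRICAL RADII.**  `p ≥ 0` a normalised target
density; `q, q' > 0` normalised model densities with weight ceilings `p ≤ Wq`, `p ≤ W'q'`; parity
`|log q − log q'| ≤ δ` off a measurable `E`, `δ ≥ 0`; `ESS = (∫ p²/q)⁻¹`, `ESS' = (∫ p²/q')⁻¹`.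
LEGS: independent draws `xᵢ` (`i ∈ s`, `n = #s ≥ 1`) from `q` with squared-weight failure sum
`Σ̂ = Σ 1_E(xᵢ)(p/q)²(xᵢ)` and `R̂ = Σ̂/n + √(2W²a·Σ̂/n) + 2W²a`; independent draws `x'ⱼ`
(`j ∈ s'`, `n' ≥ 1`) from `q'` with `R̂'` likewise (`W'`, `a'`); nothing assumed between the legs;
`a, a' ≥ 0`.  Then `P( (e^{δ} − 1) + R̂ + R̂' < |ESS − ESS'| ) ≤ e^{−na} + e^{−n'a'}`. [ours] -/
theorem ess_parityLeg_selfRadius_confidence {p q q' : X → ℝ} (hp0 : ∀ y, 0 ≤ p y)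
    (hpm : Measurable p) (hpi : Integrable p μ) (hp1 : ∫ y, p y ∂μ = 1) (hq0 : ∀ y, 0 < q y)
    (hqm : Measurable q) (hqi : Integrable q μ) (hq1 : ∫ y, q y ∂μ = 1) (hq0' : ∀ y, 0 < q' y)
    (hqm' : Measurable q') (hqi' : Integrable q' μ) (hq1' : ∫ y, q' y ∂μ = 1) {W W' : ℝ}
    (hW : ∀ y, p y ≤ W * q y) (hW' : ∀ y, p y ≤ W' * q' y) {E : Set X} (hE : MeasurableSet E)
    {δ : ℝ} (hδ : 0 ≤ δ) (hlog : ∀ y, y ∉ E → |Real.log (q y) - Real.log (q' y)| ≤ δ)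
    {x : ι → Ω → X} (hind : iIndepFun x P) (hxm : ∀ i, Measurable (x i))
    (hlaw : ∀ i, Measure.map (x i) P = μ.withDensity fun y => ENNReal.ofReal (q y))
    {ι' : Type*} {x' : ι' → Ω → X} (hind' : iIndepFun x' P) (hxm' : ∀ j, Measurable (x' j))
    (hlaw' : ∀ j, Measure.map (x' j) P = μ.withDensity fun y => ENNReal.ofReal (q' y))
    (s : Finset ι) (s' : Finset ι') (hs : 0 < s.card) (hs' : 0 < s'.card) {a a' : ℝ}
    (ha : 0 ≤ a) (ha' : 0 ≤ a') :
    P.real {ω | (Real.exp δ - 1)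
          + ((∑ i ∈ s, E.indicator (fun y => (p y / q y) ^ 2) (x i ω)) / s.card
              + Real.sqrt (2 * (W ^ 2 * a)
                  * ((∑ i ∈ s, E.indicator (fun y => (p y / q y) ^ 2) (x i ω)) / s.card))
              + 2 * (W ^ 2 * a))
          + ((∑ j ∈ s', E.indicator (fun y => (p y / q' y) ^ 2) (x' j ω)) / s'.card
              + Real.sqrt (2 * (W' ^ 2 * a')
                  * ((∑ j ∈ s', E.indicator (fun y => (p y / q' y) ^ 2) (x' j ω)) / s'.card))
              + 2 * (W' ^ 2 * a'))
        < |(∫ y, p y ^ 2 / q y ∂μ)⁻¹ - (∫ y, p y ^ 2 / q' y ∂μ)⁻¹|}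
      ≤ Real.exp (-(s.card * a)) + Real.exp (-(s'.card * a')) := by
  have hI := integrable_sq_div_of_weightBound hp0 hpm hpi hq0 hqm hW
  have hI' := integrable_sq_div_of_weightBound hp0 hpm hpi hq0' hqm' hW'
  have hlawE := TargetSideParityESS.abs_inv_integral_sq_div_sub_le_of_logParityOff hpi hp1 hq0 hqi
    hq1 hq0' hqi' hq1' hI hI' hE hδ hlog
  have hM1' : 1 ≤ ∫ y, p y ^ 2 / q' y ∂μ :=
    TargetSideParityESS.one_le_integral_sq_div hpi hp1 hq0' hqi' hq1' hI'
  have hinv1' : (∫ y, p y ^ 2 / q' y ∂μ)⁻¹ ≤ 1 := inv_le_one_of_one_le₀ hM1'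
  have hexp : 0 ≤ Real.exp δ - 1 := by linarith [Real.add_one_le_exp δ]
  have hWpos : 0 < W := weightLevel_pos hp0 hp1 hq0 hW
  have hWpos' : 0 < W' := weightLevel_pos hp0 hp1 hq0' hW'
  have hA := sqWeightMass_le_weightedFreq_selfRadius_confidence hind hxm hq0 hqm hlaw hp0 hpm hWpos
    hW hE ha s hs
  have hA' := sqWeightMass_le_weightedFreq_selfRadius_confidence hind' hxm' hq0' hqm' hlaw' hp0 hpm
    hWpos' hW' hE ha' s' hs'
  set R : Ω → ℝ := fun ω => (∑ i ∈ s, E.indicator (fun y => (p y / q y) ^ 2) (x i ω)) / s.card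
      + Real.sqrt (2 * (W ^ 2 * a)
          * ((∑ i ∈ s, E.indicator (fun y => (p y / q y) ^ 2) (x i ω)) / s.card))
      + 2 * (W ^ 2 * a) with hR
  set R' : Ω → ℝ := fun ω => (∑ j ∈ s', E.indicator (fun y => (p y / q' y) ^ 2) (x' j ω)) / s'.card
      + Real.sqrt (2 * (W' ^ 2 * a')
          * ((∑ j ∈ s', E.indicator (fun y => (p y / q' y) ^ 2) (x' j ω)) / s'.card))
      + 2 * (W' ^ 2 * a') with hR'
  have hsub : {ω | (Real.exp δ - 1) + R ω + R' ω
        < |(∫ y, p y ^ 2 / q y ∂μ)⁻¹ - (∫ y, p y ^ 2 / q' y ∂μ)⁻¹|}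
      ⊆ {ω | R ω ≤ ∫ y in E, p y ^ 2 / q y ∂μ} ∪ {ω | R' ω ≤ ∫ y in E, p y ^ 2 / q' y ∂μ} := by
    intro ω hω
    simp only [mem_setOf_eq, mem_union] at hω ⊢
    by_contra hcon
    obtain ⟨h1, h2⟩ := not_or.mp hcon
    have h1 := not_le.mp h1
    have h2 := not_le.mp h2
    have h3 : (Real.exp δ - 1) * (∫ y, p y ^ 2 / q' y ∂μ)⁻¹ ≤ Real.exp δ - 1 := by
      have := mul_le_mul_of_nonneg_left hinv1' hexp
      linarith
    linarith
  calc P.real {ω | (Real.exp δ - 1) + R ω + R' ω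
          < |(∫ y, p y ^ 2 / q y ∂μ)⁻¹ - (∫ y, p y ^ 2 / q' y ∂μ)⁻¹|}
      ≤ P.real ({ω | R ω ≤ ∫ y in E, p y ^ 2 / q y ∂μ}
          ∪ {ω | R' ω ≤ ∫ y in E, p y ^ 2 / q' y ∂μ}) := measureReal_mono hsub
    _ ≤ P.real {ω | R ω ≤ ∫ y in E, p y ^ 2 / q y ∂μ}
          + P.real {ω | R' ω ≤ ∫ y in E, p y ^ 2 / q' y ∂μ} := measureReal_union_le _ _
    _ ≤ Real.exp (-(s.card * a)) + Real.exp (-(s'.card * a')) := add_le_add hA hA'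

end Summit.Ventures.LatticeQCDFlow.Scoring.ParityLeg

end
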